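import Mathlib
import Literature.AlgebraicGeometry.Resolution.PointBlowupFlagInvariant
import Summits.ResolutionOfSingularities.ResolutionOfSingularities.Theorems.WeightedInvariantLocalWeightedDropInsepCleaning
import Summits.ResolutionOfSingularities.ResolutionOfSingularities.Theorems.WeightedInvariantLocalWeightedDropInsepNewtonVMove
import Summits.ResolutionOfSingularities.ResolutionOfSingularities.Theorems.WeightedInvariantLocalWeightedDropInsepNewtonHMove
import HarnessLib

/-!
# `WeightedInvariant.LocalWeightedDrop`, line `hasse-ridge-face-selection`: CLEAN SERIES STAY CLEAN under Hauser–Wagner's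
# vertical and horizontal moves (characteristic `2`): the successors of `…InsepNewtonVMove` / `…InsepNewtonHMove` of a
# series without square monomials have no square monomials

Crux item stmt-ResolutionOfSingularities-8899 `LocalWeightedDrop` (route `ResolutionOfSingularities/WeightedInvariant`),
serving the door `WeightedConstruction` stmt-ResolutionOfSingularities-0571.  [OURS · L1 W4.3, chain w43, support typer
res-L1-type-o7 (seat res-D-pv-023): offer (o2) of `D/res-D-pv-023/NP-API.md` §4 for the S2iM assembly M6/M7 of
res-L1-w43-stub-3 / -stub-8 (`stub_charTwoInseparableReductionWon` via Hauser–Wagner 2014 Thm 2 (i)); NOT a statement of any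
manuscript; elementary.]

Hauser–Wagner measure the CLEANED representative `F` of the class `f ∈ R/R^p` («expansions … without any `p`-th power monomials»,
L'Enseignement Math. 60 (2014) §4 p. 187 l. 36 – p. 188 l. 10), and the tree's height / slope laws for the moves (V) and (H)
(`InsepNewton.heightPS_vSucc_succ_le`, `heightPS_hSucc_le`, `slopePS_hSucc_add`) are stated for the RAW successor `A′`
(`π^* A = X₀² A′`).  This file closes the bookkeeping gap between the two: for `p = 2` the raw successor of a clean series IS clean,
so those laws apply verbatim to the cleaned successor and no «cleaning does not raise the height» lemma (false in general) is
needed in the assembly.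

* `isClean_iff` — `cleanSeries q H = H ↔` no support point has all exponents divisible by `q`;
* `cleanSeries_vSucc_eq_self` — (V): `(a, b) ∈ supp A′ ↔ (a + 2 − b, b) ∈ supp A`; both coordinates even ⇒ both even upstairs;
* `cleanSeries_hSucc_eq_self` — (H): `(a, b) ∈ supp A′ ↔ (b, a + 2 − b) ∈ supp A`; idem.
(The translational move (T) `F(yz + tz, z)` does NOT preserve cleanness — it mixes monomials; Hauser–Wagner re-clean there and
pay with Lemma 3 / Prop 2, stub-3's M4/M5.) [cite: HauserWagner2014, §4 p. 187 l. 36 – p. 188 l. 10; §6.1 (V), (H)]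
-/

set_option linter.dupNamespace false -- mandated namespace of this single-conjunct summit

namespace Summit.ResolutionOfSingularities.ResolutionOfSingularities.Theorems

namespace InsepNewton

open MvPowerSeries
open Literature.AlgebraicGeometry.Resolution
open Literature.AlgebraicGeometry.Resolution.HauserPerlega2024 (cleanSeries)

variable {K : Type} [Field K] {σ : Type}

/-- A series is CLEAN (`cleanSeries q H = H`) iff no support point has all its exponents divisible by `q`. [folklore] -/
theorem isClean_iff (q : ℕ) (H : MvPowerSeries σ K) :
    cleanSeries q H = H ↔ ∀ d : σ →₀ ℕ, (∀ i, q ∣ d i) → coeff d H = 0 := by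
  classical
  constructor
  · intro h d hd
    have := MvPowerSeries.ext_iff.mp h d
    rw [InsepCleaning.coeff_cleanSeries, if_pos hd] at this
    exact this.symm
  · intro h
    ext d
    rw [InsepCleaning.coeff_cleanSeries]
    split_ifs with hd
    · exact (h d hd).symm
    · rfl

section CharTwoMoves

variable {A A' : MvPowerSeries (Fin 2) K}

/-- Both coordinates of a two-letter exponent `(a, b)` are even iff `a` and `b` are. -/
theorem forall_two_dvd_pair_iff (a b : ℕ) :
    (∀ i : Fin 2, 2 ∣ (Finsupp.single (0 : Fin 2) a + Finsupp.single 1 b : Fin 2 →₀ ℕ) i) ↔ 2 ∣ a ∧ 2 ∣ b := by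
  constructor
  · intro h
    have h0 := h 0
    have h1 := h 1
    rw [pair_apply_zero] at h0
    rw [pair_apply_one] at h1
    exact ⟨h0, h1⟩
  · rintro ⟨ha, hb⟩ i
    rcases (by fin_cases i <;> simp : i = 0 ∨ i = 1) with rfl | rfl
    · rwa [pair_apply_zero]
    · rwa [pair_apply_one]

/-- **THE VERTICAL MOVE KEEPS CLEAN SERIES CLEAN** (characteristic-2 spelling of `…InsepNewtonVMove`: `π_V^* A = X₀² A′` at the
point `c = (c₀, 0)`, any `c₀`): if `A` has no square monomials then neither has `A′`. [cite: HauserWagner2014, §6.1 (V)] -/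
theorem cleanSeries_vSucc_eq_self (c₀ : K)
    (hfac : subst (fun l : Fin 2 => if l = 0 then C c₀ * X 0 else (X 0 * X 1 : MvPowerSeries (Fin 2) K)) A = X 0 ^ 2 * A')
    (hA : cleanSeries 2 A = A) : cleanSeries 2 A' = A' := by
  rw [isClean_iff] at hA ⊢
  intro d hd
  have hd' : d = Finsupp.single 0 (d 0) + Finsupp.single 1 (d 1) := by
    ext l
    rcases (by fin_cases l <;> simp : l = 0 ∨ l = 1) with rfl | rfl <;> simp
  obtain ⟨h0, h1⟩ := (forall_two_dvd_pair_iff (d 0) (d 1)).mp (hd' ▸ hd)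
  rw [coeff_vSucc c₀ hfac]
  split_ifs with hle
  · rw [hA _ ((forall_two_dvd_pair_iff _ _).mpr ⟨?_, h1⟩), mul_zero]
    -- `d 0 + 2 − d 1` is even
    obtain ⟨a, ha⟩ := h0
    obtain ⟨b, hb⟩ := h1
    exact ⟨a + 1 - b, by omega⟩
  · rfl

/-- **THE HORIZONTAL MOVE KEEPS CLEAN SERIES CLEAN** (characteristic-2 spelling of `…InsepNewtonHMove`: `π_H^* A = X₀² A′` at the
point `c = (0, c₁)`, any `c₁`): if `A` has no square monomials then neither has `A′`. [cite: HauserWagner2014, §6.1 (H)] -/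
theorem cleanSeries_hSucc_eq_self (c₁ : K)
    (hfac : subst (fun l : Fin 2 => if l = 1 then C c₁ * X 0 else (X 0 * X 1 : MvPowerSeries (Fin 2) K)) A = X 0 ^ 2 * A')
    (hA : cleanSeries 2 A = A) : cleanSeries 2 A' = A' := by
  rw [isClean_iff] at hA ⊢
  intro d hd
  have hd' : d = Finsupp.single 0 (d 0) + Finsupp.single 1 (d 1) := by
    ext l
    rcases (by fin_cases l <;> simp : l = 0 ∨ l = 1) with rfl | rfl <;> simp
  obtain ⟨h0, h1⟩ := (forall_two_dvd_pair_iff (d 0) (d 1)).mp (hd' ▸ hd)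
  rw [coeff_hSucc c₁ hfac]
  split_ifs with hle
  · rw [hA _ ((forall_two_dvd_pair_iff _ _).mpr ⟨h1, ?_⟩), mul_zero]
    -- `d 0 + 2 − d 1` is even
    obtain ⟨a, ha⟩ := h0
    obtain ⟨b, hb⟩ := h1
    exact ⟨a + 1 - b, by omega⟩
  · rfl

end CharTwoMoves

end InsepNewton

end Summit.ResolutionOfSingularities.ResolutionOfSingularities.Theorems
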